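import Summits.QuantumFields.YangMills.Theorems.AlphaInputsT3ACv3StepTrivPinsChartLocal
import Summits.QuantumFields.YangMills.Theorems.AlphaInputsT3ACBlockAvgEMLWeightedFibreChart
import Summits.QuantumFields.YangMills.Theorems.AlphaInputsT3AC
import HarnessLib

/-!
# `AlphaInputsT3ACv3StepTrivPinsBlockAvgKnit` — THE RECORD KNIT: both trivial-history fibre rows (`PinnedStep.Fibre55WinAC … triv′`,
# `PinnedStep.Fibre57LowOnAC lo k`) for an AC tower whose level-`k` averaging IS Bałaban's block averaging with the printed `exp[mean log]`
# (`(X.av k).avg = avgFun expMeanLogSU`, the T³ record's `AlphaInputsT3AC.avT3_of_le`), modulo print's (55) pins and ONE size line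
# (cell ym3-torus; desk pub/ym-inputs INPUT-LIST v8 §3 I-10 ∕ I-12; memos `I10-B2-FIBRE-LOCATE-p08.md`, `B2F2-CHART-LOCATE-p08g3.md` §5; seat ym-inputs-p08 g3;
# helper `--supports stmt-QuantumFields-20520`)

WHAT.  `G = SU(N_c)` (record: `N_c = 2`), `k + 1 ≤ m + K`, `(X.av k).avg = avgFun expMeanLogSU` (displayed `hav`).  Given the chart data of
`BlockAvgEMLWeightedFibreChart.exists_weightedFibreChart_global` AS DISPLAYED BINDERS — `Φ`, `J`, `T` with `hΦ hJ hT`, the measure identity `hmap` on the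
small-loop region `O_ε = {U | ∀ c i, dist1 (loopHol U c i) < ε}` and the global fibre landing `hfib : ∀ z, Ū(Φ z) = z.1` (a B0 definer instantiates them by
`Classical.choose`; nothing is chosen here) — and the size line `0 ≤ ε₁(k)`, `((d+2)L)²ε₁(k)/4 < ε` (so `{χB_k(triv′) ≠ 0} ⊆ O_ε`,
`BlockAvgEMLWeightedFibreChart.loopSmall_of_chiB_triv_ne_zero`), the two rows follow from `PinnedStepTrivPins.fibre55WinAC_triv_of_localChart` ∕
`fibre57LowOnAC_of_localChart` with `Ω :=` the level-`k` fine fields, `vol := fieldMeasure`, local `hchart := localChart_of_hmap`, weight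
`J′ := e^{−(ℓσ + d_g·log g_k)·N}·𝟙_T·J`, and the pins `hZU`∕`hFl` (∕`hpos`) written against `(fieldMeasure, q, J′, Φ)`:
`fibre55WinAC_triv_of_blockAvgChart`, `fibre57LowOnAC_of_blockAvgChart`.  Also `eps_le_delta_two`: at `N_c = 2` the guard radius `δ₂ = 1/3` absorbs `ε ≤ 1/10`; and `avg_XT3_eq_avgFun`: the displayed `hav` HOLDS for the T³
record's pinned AC inputs `AlphaInputsT3AC.XT3` (`XT3_av`, `avT3_of_le`).
So at the record the I-10 ∕ I-12 trivial-history members read: PINS (B0's `𝔖_Bal`) + displayed data rows + `((d+2)L)²ε₁(k)/4 < ε ≤ min(1/10, (10·|Idx P|)⁻¹)`.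

HONEST SCOPE.  [folklore] plumbing of landed files; nothing of [Balaban1985UV3] asserted; NO (O″χ) row is discharged at free data (RULING g26-№2) — the rows
are proved MODULO the pins and the displayed rows; count-neutral; no summit ∕ sub-problem statement proved (rung R3 bookkeeping; not T⁴, not Clay; the
Yang–Mills mass gap is NOT proved).  Def-free; L-floor: none beyond `k + 1 ≤ m + K` and the size line.
References: T. Bałaban, CMP 102 (1985) 255–275 [Balaban1985UV3] ((13)–(18) pp.259–260, (49)–(58) pp.268–270); CMP 109 (1987) 249–301 [Balaban1987RG1] ((0.4) p.253).
-/

set_option autoImplicit false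

noncomputable section

namespace Summit.QuantumFields.YangMills.Theorems.PinnedStepTrivPins

open MeasureTheory Literature.MathematicalPhysics.QuantumFieldTheory.Balaban1983to89
open Literature.MathematicalPhysics.QuantumFieldTheory.Balaban1983to89.AveragingRT (rnTransport)
open Literature.MathematicalPhysics.QuantumFieldTheory.Balaban1983to89.GaugeField (GaugeInvariant gaugeAct)
open Literature.MathematicalPhysics.QuantumFieldTheory.Balaban1983to89.BlockAveraging (avgFun loopHol Idx)
open Literature.MathematicalPhysics.QuantumFieldTheory.Balaban1983to89.ExpMeanLog (expMeanLogSU)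
open Literature.MathematicalPhysics.QuantumFieldTheory.Balaban1983to89.T3ContinuumYM3Torus (T3Family)
open Literature.MathematicalPhysics.QuantumFieldTheory.Balaban1985CMP102 Literature.MathematicalPhysics.QuantumFieldTheory.Balaban1985CMP102.Setting
open Summit.QuantumFields.Balaban3D.Carriers
open Summit.QuantumFields.Balaban3D.Proofs.Inputs (LaneConsts)
open Summit.QuantumFields.Balaban3D.Proofs.TowerAC Summit.QuantumFields.Balaban3D.Proofs.StandardAC Summit.QuantumFields.Balaban3D.Proofs.InputsAC
open Summit.QuantumFields.Balaban3D.Proofs.Bound55Masses (chiB)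
open Summit.QuantumFields.Balaban3D.Proofs.GaussianNormalization (partZ normalized)
open Summit.QuantumFields.YangMills.Theorems.PinnedStep (wtP Fibre55WinAC Fibre57LowOnAC)
open Summit.QuantumFields.YangMills.Theorems.BlockAvgEMLWeightedFibreChart (loopSmall_of_chiB_triv_ne_zero)
open scoped NNReal ENNReal

variable {L : ℕ} (𝔎 : LaneConsts L) {S : Scales L} {Nc : ℕ} [NeZero Nc]
  {Val : Type} [NormedAddCommGroup Val] [NormedSpace ℂ Val]
  (X : ExternalInputsAC S (Matrix.specialUnitaryGroup (Fin Nc) ℂ))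
  (𝔖 : ∀ k, StepSeries S (Matrix.specialUnitaryGroup (Fin Nc) ℂ) Val (nblkOf S 𝔎.carrier k) k)

/-- At `N_c = 2` the guard radius of the printed average is `δ₂ = min(1/3, π/2) = 1/3`, so `ε ≤ 1/10` already gives `ε ≤ δ₂` (the binder `hεδ` of
`BlockAvgEMLWeightedFibreChart.exists_weightedFibreChart(_global)` at the record). [cite: Balaban1987RG1, (0.4) p.253] -/
theorem eps_le_delta_two {ε : ℝ} (hε : ε ≤ 1 / 10) : ε ≤ (expMeanLogSU (n := Fin 2)).δ := by
  rw [ExpMeanLog.expMeanLogSU_δ, Fintype.card_fin]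
  refine le_min (hε.trans (by norm_num)) (hε.trans ?_)
  have hπ := Real.pi_gt_three
  push_cast
  linarith

/-- **THE UPPER ROW `Fibre55WinAC` AT THE TRIVIAL NEW HISTORY FOR THE BLOCK AVERAGING WITH THE PRINTED AVERAGE** (every level of the standing range,
`SU(N_c)`), modulo print's (55) pins written against the private-coordinate chart `(Φ, J, T)` of `BlockAvgEMLWeightedFibreChart.exists_weightedFibreChart_global`
(displayed binders `hΦ hJ hT hmap hfib`), the displayed data rows, and the size line `((d+2)L)²ε₁(k)/4 < ε`:
`fibre55WinAC_triv_of_localChart` ∘ `localChart_of_hmap` ∘ `loopSmall_of_chiB_triv_ne_zero`. [cite: Balaban1985UV3, (13)–(18) pp.259–260 + (49)–(55) pp.268–269 + (58) p.270] -/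
theorem fibre55WinAC_triv_of_blockAvgChart
    (win : (k : ℕ) → Hist S.P (k + 1) → Set (GaugeField S.P (k + 1) (Matrix.specialUnitaryGroup (Fin Nc) ℂ))) (k : ℕ) (hk : k + 1 ≤ S.P.m + S.P.K)
    (hav : (X.av k).avg = avgFun (expMeanLogSU (n := Fin Nc)))
    {ε : ℝ} (hεS : 0 ≤ eps1Of S 𝔎.carrier k) (hwin : ((((S.P.d + 2) * S.P.L : ℕ) : ℝ) ^ 2 / 4) * eps1Of S 𝔎.carrier k < ε)
    (Φ : GaugeField S.P (k + 1) (Matrix.specialUnitaryGroup (Fin Nc) ℂ) × GaugeField S.P k (Matrix.specialUnitaryGroup (Fin Nc) ℂ) →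
      GaugeField S.P k (Matrix.specialUnitaryGroup (Fin Nc) ℂ))
    (J : GaugeField S.P (k + 1) (Matrix.specialUnitaryGroup (Fin Nc) ℂ) × GaugeField S.P k (Matrix.specialUnitaryGroup (Fin Nc) ℂ) → ℝ≥0)
    (T : Set (GaugeField S.P (k + 1) (Matrix.specialUnitaryGroup (Fin Nc) ℂ) × GaugeField S.P k (Matrix.specialUnitaryGroup (Fin Nc) ℂ)))
    (hΦ : Measurable Φ) (hJ : Measurable J) (hT : MeasurableSet T)
    (hmap : ((((fieldMeasure S.P (k + 1) (Matrix.specialUnitaryGroup (Fin Nc) ℂ)).prod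
        (fieldMeasure S.P k (Matrix.specialUnitaryGroup (Fin Nc) ℂ))).restrict T).withDensity (fun z => (J z : ℝ≥0∞))).map Φ =
      (fieldMeasure S.P k (Matrix.specialUnitaryGroup (Fin Nc) ℂ)).restrict
        {U : GaugeField S.P k (Matrix.specialUnitaryGroup (Fin Nc) ℂ) | ∀ c i, dist1 (loopHol U c i) < ε})
    (hfib : ∀ z, avgFun (expMeanLogSU (n := Fin Nc)) (Φ z) = z.1) (N lσ dg : ℝ)
    (q : GaugeField S.P (k + 1) (Matrix.specialUnitaryGroup (Fin Nc) ℂ) → GaugeField S.P k (Matrix.specialUnitaryGroup (Fin Nc) ℂ) → ℝ)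
    (hqm : ∀ V, Measurable (q V)) (hZ : ∀ V, 0 < partZ (fieldMeasure S.P k (Matrix.specialUnitaryGroup (Fin Nc) ℂ)) (q V))
    (hU : Measurable (X.UkH k (Hist.triv S.P k))) (hPm : Measurable ((inputOfAC 𝔎 X 𝔖).Pint k (Hist.triv S.P k)))
    (cP : ℝ) (hPb : ∀ U, (inputOfAC 𝔎 X 𝔖).Pint k (Hist.triv S.P k) U ≤ cP)
    (hinv : GaugeInvariant (fun U : GaugeField S.P k (Matrix.specialUnitaryGroup (Fin Nc) ℂ) =>
      Real.exp (-((towerOfAC 𝔎 X 𝔖).mainT k (Hist.triv S.P k) U) + (towerOfAC 𝔎 X 𝔖).Pint k (Hist.triv S.P k) U)))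
    (hwt : ∀ U : GaugeField S.P k (Matrix.specialUnitaryGroup (Fin Nc) ℂ),
      chiB 𝔎.carrier.M₁ (rcolOf S 𝔎.carrier) (eps1Of S 𝔎.carrier) k (Hist.triv S.P (k + 1)) U ≠ 0 → wtP 𝔎 X win k (Hist.triv S.P k) U = 1)
    (hsmall : ∀ U : GaugeField S.P k (Matrix.specialUnitaryGroup (Fin Nc) ℂ),
      chiB 𝔎.carrier.M₁ (rcolOf S 𝔎.carrier) (eps1Of S 𝔎.carrier) k (Hist.triv S.P (k + 1)) U ≠ 0 → (X.av k).avg U ∈ win k (Hist.triv S.P (k + 1)))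
    (hσ : (piecesAC 𝔎 X 𝔖 k).logσ₀ = lσ) (hdg : (piecesAC 𝔎 X 𝔖 k).dg = dg) (hstar : (piecesAC 𝔎 X 𝔖 k).starB (Hist.triv S.P (k + 1)) = N)
    (hZU : ∀ V, (piecesAC 𝔎 X 𝔖 k).logZU (Hist.triv S.P (k + 1)) V =
      Real.log (partZ (fieldMeasure S.P k (Matrix.specialUnitaryGroup (Fin Nc) ℂ)) (q V)))
    (hFl : ∀ V, (piecesAC 𝔎 X 𝔖 k).logFl (Hist.triv S.P (k + 1)) V =
      Real.log (∫ U', (Real.exp (-((lσ + dg * Real.log (S.gk k)) * N)) * T.indicator (fun z => (J z : ℝ)) (V, U')) *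
              chiB 𝔎.carrier.M₁ (rcolOf S 𝔎.carrier) (eps1Of S 𝔎.carrier) k (Hist.triv S.P (k + 1)) (Φ (V, U')) *
              Real.exp (-((towerOfAC 𝔎 X 𝔖).mainT k (Hist.triv S.P k) (Φ (V, U')) - (towerOfAC 𝔎 X 𝔖).mainT (k + 1) (Hist.triv S.P (k + 1)) V)
                + ((towerOfAC 𝔎 X 𝔖).Pint k (Hist.triv S.P k) (Φ (V, U')) - (piecesAC 𝔎 X 𝔖 k).Pold (Hist.triv S.P (k + 1)) V) + q V U')
            ∂(normalized (fieldMeasure S.P k (Matrix.specialUnitaryGroup (Fin Nc) ℂ)) (q V)))) :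
    Fibre55WinAC 𝔎 X 𝔖 win k (Hist.triv S.P (k + 1)) := by
  have hO : ∀ U : GaugeField S.P k (Matrix.specialUnitaryGroup (Fin Nc) ℂ),
      chiB 𝔎.carrier.M₁ (rcolOf S 𝔎.carrier) (eps1Of S 𝔎.carrier) k (Hist.triv S.P (k + 1)) U ≠ 0 →
        U ∈ {U : GaugeField S.P k (Matrix.specialUnitaryGroup (Fin Nc) ℂ) | ∀ c i, dist1 (loopHol U c i) < ε} := fun U hU =>
    loopSmall_of_chiB_triv_ne_zero 𝔎.carrier.M₁ (rcolOf S 𝔎.carrier) (eps1Of S 𝔎.carrier) k hεS hwin U hU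
  have hfib' : ∀ z ∈ T, (X.av k).avg (Φ z) = z.1 := fun z _ => by rw [hav]; exact hfib z
  have hfibΦ : ∀ V U', (X.av k).avg (Φ (V, U')) = V := fun V U' => by rw [hav]; exact hfib (V, U')
  exact fibre55WinAC_triv_of_localChart 𝔎 X 𝔖 win k hk (fieldMeasure S.P k (Matrix.specialUnitaryGroup (Fin Nc) ℂ)) Φ
    (fun z => Real.exp (-((lσ + dg * Real.log (S.gk k)) * N)) * T.indicator (fun z => (J z : ℝ)) z)
    (fun z => mul_nonneg (Real.exp_pos _).le (Set.indicator_nonneg (fun _ _ => NNReal.coe_nonneg _) _)) hfibΦ N lσ dg _ hO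
    (fun ρ C hρm hρb _ hρO => localChart_of_hmap X k (fieldMeasure S.P k (Matrix.specialUnitaryGroup (Fin Nc) ℂ)) Φ J hΦ hJ hT hmap hfib' N lσ dg
      ρ C hρm hρb hρO)
    q hqm hZ hU hPm cP hPb hinv hwt hsmall hσ hdg hstar hZU hFl

/-- **THE LOWER ROW `Fibre57LowOnAC` FOR THE BLOCK AVERAGING WITH THE PRINTED AVERAGE** (every level, `SU(N_c)`), modulo the same pins + `hpos`, the
displayed rows `hlom hloinv hdom`, and the size line — `fibre57LowOnAC_of_localChart` ∘ `localChart_of_hmap` ∘ `loopSmall_of_chiB_triv_ne_zero`.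
[cite: Balaban1985UV3, (37) p.265 + (47) p.267 + (55)–(58) pp.269–270 + p.272 L32–33] -/
theorem fibre57LowOnAC_of_blockAvgChart
    (lo : (k : ℕ) → Set (GaugeField S.P k (Matrix.specialUnitaryGroup (Fin Nc) ℂ))) (k : ℕ)
    (hav : (X.av k).avg = avgFun (expMeanLogSU (n := Fin Nc)))
    {ε : ℝ} (hεS : 0 ≤ eps1Of S 𝔎.carrier k) (hwin : ((((S.P.d + 2) * S.P.L : ℕ) : ℝ) ^ 2 / 4) * eps1Of S 𝔎.carrier k < ε)
    (Φ : GaugeField S.P (k + 1) (Matrix.specialUnitaryGroup (Fin Nc) ℂ) × GaugeField S.P k (Matrix.specialUnitaryGroup (Fin Nc) ℂ) →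
      GaugeField S.P k (Matrix.specialUnitaryGroup (Fin Nc) ℂ))
    (J : GaugeField S.P (k + 1) (Matrix.specialUnitaryGroup (Fin Nc) ℂ) × GaugeField S.P k (Matrix.specialUnitaryGroup (Fin Nc) ℂ) → ℝ≥0)
    (T : Set (GaugeField S.P (k + 1) (Matrix.specialUnitaryGroup (Fin Nc) ℂ) × GaugeField S.P k (Matrix.specialUnitaryGroup (Fin Nc) ℂ)))
    (hΦ : Measurable Φ) (hJ : Measurable J) (hT : MeasurableSet T)
    (hmap : ((((fieldMeasure S.P (k + 1) (Matrix.specialUnitaryGroup (Fin Nc) ℂ)).prod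
        (fieldMeasure S.P k (Matrix.specialUnitaryGroup (Fin Nc) ℂ))).restrict T).withDensity (fun z => (J z : ℝ≥0∞))).map Φ =
      (fieldMeasure S.P k (Matrix.specialUnitaryGroup (Fin Nc) ℂ)).restrict
        {U : GaugeField S.P k (Matrix.specialUnitaryGroup (Fin Nc) ℂ) | ∀ c i, dist1 (loopHol U c i) < ε})
    (hfib : ∀ z ∈ T, avgFun (expMeanLogSU (n := Fin Nc)) (Φ z) = z.1) (N lσ dg : ℝ)
    (q : GaugeField S.P (k + 1) (Matrix.specialUnitaryGroup (Fin Nc) ℂ) → GaugeField S.P k (Matrix.specialUnitaryGroup (Fin Nc) ℂ) → ℝ)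
    (hqm : ∀ V, Measurable (q V)) (hZ : ∀ V, 0 < partZ (fieldMeasure S.P k (Matrix.specialUnitaryGroup (Fin Nc) ℂ)) (q V))
    (hU : Measurable (X.UkH k (Hist.triv S.P k))) (hPm : Measurable ((inputOfAC 𝔎 X 𝔖).Pint k (Hist.triv S.P k)))
    (cP : ℝ) (hPb : ∀ U, (inputOfAC 𝔎 X 𝔖).Pint k (Hist.triv S.P k) U ≤ cP)
    (hinv : GaugeInvariant (fun U : GaugeField S.P k (Matrix.specialUnitaryGroup (Fin Nc) ℂ) =>
      Real.exp (-((towerOfAC 𝔎 X 𝔖).mainT k (Hist.triv S.P k) U) + (towerOfAC 𝔎 X 𝔖).Pint k (Hist.triv S.P k) U)))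
    (hlom : MeasurableSet (lo k))
    (hloinv : ∀ (u : GaugeTransf S.P k (Matrix.specialUnitaryGroup (Fin Nc) ℂ)) (U : GaugeField S.P k (Matrix.specialUnitaryGroup (Fin Nc) ℂ)),
      gaugeAct u U ∈ lo k ↔ U ∈ lo k)
    (hdom : ∀ U : GaugeField S.P k (Matrix.specialUnitaryGroup (Fin Nc) ℂ),
      chiB 𝔎.carrier.M₁ (rcolOf S 𝔎.carrier) (eps1Of S 𝔎.carrier) k (Hist.triv S.P (k + 1)) U ≠ 0 → U ∈ lo k)
    (hσ : (piecesAC 𝔎 X 𝔖 k).logσ₀ = lσ) (hdg : (piecesAC 𝔎 X 𝔖 k).dg = dg) (hstar : (piecesAC 𝔎 X 𝔖 k).starB (Hist.triv S.P (k + 1)) = N)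
    (hZU : ∀ V, (piecesAC 𝔎 X 𝔖 k).logZU (Hist.triv S.P (k + 1)) V =
      Real.log (partZ (fieldMeasure S.P k (Matrix.specialUnitaryGroup (Fin Nc) ℂ)) (q V)))
    (hFl : ∀ V, (piecesAC 𝔎 X 𝔖 k).logFl (Hist.triv S.P (k + 1)) V =
      Real.log (∫ U', (Real.exp (-((lσ + dg * Real.log (S.gk k)) * N)) * T.indicator (fun z => (J z : ℝ)) (V, U')) *
              chiB 𝔎.carrier.M₁ (rcolOf S 𝔎.carrier) (eps1Of S 𝔎.carrier) k (Hist.triv S.P (k + 1)) (Φ (V, U')) *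
              Real.exp (-((towerOfAC 𝔎 X 𝔖).mainT k (Hist.triv S.P k) (Φ (V, U')) - (towerOfAC 𝔎 X 𝔖).mainT (k + 1) (Hist.triv S.P (k + 1)) V)
                + ((towerOfAC 𝔎 X 𝔖).Pint k (Hist.triv S.P k) (Φ (V, U')) - (piecesAC 𝔎 X 𝔖 k).Pold (Hist.triv S.P (k + 1)) V) + q V U')
            ∂(normalized (fieldMeasure S.P k (Matrix.specialUnitaryGroup (Fin Nc) ℂ)) (q V))))
    (hpos : ∀ V, V ∈ lo (k + 1) →
      0 < ∫ U', (Real.exp (-((lσ + dg * Real.log (S.gk k)) * N)) * T.indicator (fun z => (J z : ℝ)) (V, U')) *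
              chiB 𝔎.carrier.M₁ (rcolOf S 𝔎.carrier) (eps1Of S 𝔎.carrier) k (Hist.triv S.P (k + 1)) (Φ (V, U')) *
              Real.exp (-((towerOfAC 𝔎 X 𝔖).mainT k (Hist.triv S.P k) (Φ (V, U')) - (towerOfAC 𝔎 X 𝔖).mainT (k + 1) (Hist.triv S.P (k + 1)) V)
                + ((towerOfAC 𝔎 X 𝔖).Pint k (Hist.triv S.P k) (Φ (V, U')) - (piecesAC 𝔎 X 𝔖 k).Pold (Hist.triv S.P (k + 1)) V) + q V U')
            ∂(normalized (fieldMeasure S.P k (Matrix.specialUnitaryGroup (Fin Nc) ℂ)) (q V))) :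
    Fibre57LowOnAC 𝔎 X 𝔖 lo k := by
  have hO : ∀ U : GaugeField S.P k (Matrix.specialUnitaryGroup (Fin Nc) ℂ),
      chiB 𝔎.carrier.M₁ (rcolOf S 𝔎.carrier) (eps1Of S 𝔎.carrier) k (Hist.triv S.P (k + 1)) U ≠ 0 →
        U ∈ {U : GaugeField S.P k (Matrix.specialUnitaryGroup (Fin Nc) ℂ) | ∀ c i, dist1 (loopHol U c i) < ε} := fun U hU =>
    loopSmall_of_chiB_triv_ne_zero 𝔎.carrier.M₁ (rcolOf S 𝔎.carrier) (eps1Of S 𝔎.carrier) k hεS hwin U hU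
  have hfib' : ∀ z ∈ T, (X.av k).avg (Φ z) = z.1 := fun z hz => by rw [hav]; exact hfib z hz
  exact fibre57LowOnAC_of_localChart 𝔎 X 𝔖 lo k (fieldMeasure S.P k (Matrix.specialUnitaryGroup (Fin Nc) ℂ)) Φ
    (fun z => Real.exp (-((lσ + dg * Real.log (S.gk k)) * N)) * T.indicator (fun z => (J z : ℝ)) z)
    (fun z => mul_nonneg (Real.exp_pos _).le (Set.indicator_nonneg (fun _ _ => NNReal.coe_nonneg _) _)) N lσ dg _ hO
    (fun ρ C hρm hρb _ hρO => localChart_of_hmap X k (fieldMeasure S.P k (Matrix.specialUnitaryGroup (Fin Nc) ℂ)) Φ J hΦ hJ hT hmap hfib' N lσ dg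
      ρ C hρm hρb hρO)
    q hqm hZ hU hPm cP hPb hinv hlom hloinv hdom hσ hdg hstar hZU hFl hpos

/-! ## The record's averaging: `hav` discharged for the pinned AC inputs `XT3` of `AlphaInputsT3AC` -/

/-- **AT THE T³ RECORD `hav` HOLDS**: the pinned AC external inputs `XT3` of `AlphaInputsT3AC` average at every level of the standing range by
`avgFun ℰp`, `ℰp = expMeanLogSU` on `SU(2)` (`XT3_av`, `avT3_of_le`) — so `fibre55WinAC_triv_of_blockAvgChart` ∕ `fibre57LowOnAC_of_blockAvgChart` apply to
`X := XT3 …` with `S := T3Scales …` (`(T3Scales …).P = F.P K` by `rfl`) and `hεδ` by `eps_le_delta_two`. [cite: Balaban1987RG1, (0.4) p.253] -/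
theorem avg_XT3_eq_avgFun (F : T3Family) (γ : ℝ) (hγ : 0 < γ) (hγ1 : γ ≤ 1) (K : ℕ)
    (reg : ℕ → Set (GaugeField (F.P K) 0 (Matrix.specialUnitaryGroup (Fin 2) ℂ)))
    (Uk : (k : ℕ) → GaugeField (F.P K) (k + 1) (Matrix.specialUnitaryGroup (Fin 2) ℂ) →
      GaugeField (F.P K) 0 (Matrix.specialUnitaryGroup (Fin 2) ℂ))
    (UkH : (k : ℕ) → Hist (F.P K) k → GaugeField (F.P K) k (Matrix.specialUnitaryGroup (Fin 2) ℂ) →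
      GaugeField (F.P K) 0 (Matrix.specialUnitaryGroup (Fin 2) ℂ))
    (hU0 : ∀ V : GaugeField (F.P K) 0 (Matrix.specialUnitaryGroup (Fin 2) ℂ), UkH 0 (Hist.triv (F.P K) 0) V = V)
    (hUs : ∀ (k : ℕ) (V : GaugeField (F.P K) (k + 1) (Matrix.specialUnitaryGroup (Fin 2) ℂ)), UkH (k + 1) (Hist.triv (F.P K) (k + 1)) V = Uk k V)
    {k : ℕ} (hk : k + 1 ≤ F.m + K) :
    ((XT3 F γ hγ hγ1 K reg Uk UkH hU0 hUs).av k).avg = avgFun (expMeanLogSU (n := Fin 2)) := by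
  rw [XT3_av, avT3_of_le F K hk]; rfl

end Summit.QuantumFields.YangMills.Theorems.PinnedStepTrivPins

end
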